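import Mathlib
import Summits.QuantumFields.YangMills.Theses.SpecificationCompactness
import Summits.QuantumFields.YangMills.Theorems.SpecificationCompactnessSpecificationFromCocycle
import HarnessLib

/-!
# Route `SpecificationCompactness`, LINE 15 «cocycle_limit» (crux `SpecificationLimitAE`, stmt-QuantumFields-22688): the REGISTERED STUB
# `stub_specificationFromCocycle` BY NAME AND SIGNATURE

Per the planner's STUB-PLAN-B-D.md (ym-idea-5 g10: «copy the skeleton's abbrevs verbatim»), this file reproduces the skeleton's
abbreviations and stub statements (`G2`, `haarG`, `X0`, `pi0`, `envSigma`, `ud`, `pK`, `R`, `CruxBody`, `UnitDensityPosAE`, `CocycleLimitAt`,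
`CocycleLimitInMeasure`, `FibreUIAt`, `FibreUI`, `SpecificationFromCocycle`, `SmallFieldCocycleLimit`, `__Registered.*`) VERBATIM from
`lineK15-cocycle_limit/bc/SpecificationLimitAE_cocycle.lean` and proves the registered stub
`theorem stub_specificationFromCocycle : __Registered.stub_specificationFromCocycle` by the landed assembly
`Theorems.SpecificationCompactnessSpecificationFromCocycle.specificationFromCocycle` (kernels p652738 / p652950 / K3).  Cell `ym-idea-1`
width seat `ym-line-sfw-p2-w3` gen 27 (free hands).  HONEST FRAMING: the other stubs (A `stub_cocycleLimitInMeasure`, C `stub_fibreUI`,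
D `stub_unitDensityPosAE`) are NOT proved here; no crux, route, rung or mass gap is proved.
-/

noncomputable section

namespace Summit.QuantumFields.YangMills.Cruxes.SpecificationLimitAE.CocycleLimit

open scoped BigOperators Topology Classical MeasureTheory ProbabilityTheory NNReal ENNReal
open Filter Set Function MeasureTheory
open Literature.MathematicalPhysics.QuantumFieldTheory
open Literature.MathematicalPhysics.QuantumFieldTheory.Balaban1983to89

/-- The gauge group `SU(2)`. -/
abbrev G2 : Type := Matrix.specialUnitaryGroup (Fin 2) ℂ

/-- Normalised Haar measure on one link (the tree's `HaarData` datum used by `fieldMeasure`). -/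
noncomputable abbrev haarG : Measure G2 := (HaarData.haar : Measure G2)

variable (F : T3ContinuumYM3Torus.T3Family)

/-- The fixed unit-lattice configuration space `X₀ = SU(2)^{unit bonds}`. -/
abbrev X0 : Type := GaugeField (F.P 0) 0 G2

/-- Normalised product Haar measure `π₀` on `X₀`. -/
noncomputable abbrev pi0 : Measure (X0 F) := fieldMeasure (F.P 0) 0 G2

/-- The σ-algebra generated by all unit links except `e`. -/
noncomputable abbrev envSigma (e : PBond (F.P 0) 0) : MeasurableSpace (X0 F) :=
  MeasurableSpace.comap (fun (W : X0 F) (b : {b : PBond (F.P 0) 0 // b ≠ e}) => W b.1) MeasurableSpace.pi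

/-- Bałaban's canonical (unnormalised) renormalised unit density `ρ̂_K` read on the unit labels (tree). -/
noncomputable abbrev ud (γ : ℝ) (K : ℕ) : X0 F → ℝ := T3UnitLawDensityEML.unitDensity F γ K

/-- The canonical single-link conditional density of link `e` under `ρ_K`. -/
noncomputable abbrev pK (γ : ℝ) (K : ℕ) (e : PBond (F.P 0) 0) (V : X0 F) : ℝ :=
  ud F γ K V / condExp (envSigma F e) (pi0 F) (ud F γ K) V

/-- THE LEVER: the one-link likelihood-ratio cocycle `R_{K,e}(V,h) = ρ̂_K(V^{e→h}) / ρ̂_K(V)` (junk `0` where `ρ̂_K(V) = 0`). -/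
noncomputable abbrev R (γ : ℝ) (K : ℕ) (e : PBond (F.P 0) 0) (V : X0 F) (h : G2) : ℝ :=
  ud F γ K (Function.update V e h) / ud F γ K V


/-- The crux body for one `(F, γ)` (textual copy of `SpecificationLimitAE`'s matrix). -/
def CruxBody (γ : ℝ) : Prop :=
  ∃ q : PBond (F.P 0) 0 → X0 F → ℝ, (∀ e, Measurable (q e)) ∧ (∀ e V, 0 ≤ q e V) ∧ (∀ e, ∀ᵐ V ∂(pi0 F), 0 < q e V) ∧
    (∀ e, ∀ᵐ V ∂(pi0 F), condExp (envSigma F e) (pi0 F) (q e) V = 1) ∧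
    ∀ e, TendstoInMeasure (pi0 F) (fun (K : ℕ) (V : X0 F) => pK F γ K e V) atTop (q e)

/-! ## Stub statements -/

/-- STUB D (M, provable now): the renormalised unit density is `π₀`-a.e. POSITIVE at every step. -/
def UnitDensityPosAE : Prop :=
  ∀ (F : T3ContinuumYM3Torus.T3Family) (γ : ℝ), 0 < γ → ∀ K : ℕ, ∀ᵐ V ∂(pi0 F), 0 < ud F γ K V

/-- The in-measure cocycle-limit clause for one `(F, γ, e)`. -/
def CocycleLimitAt (γ : ℝ) (e : PBond (F.P 0) 0) : Prop :=
  ∃ Re : X0 F × G2 → ℝ, Measurable Re ∧ (∀ᵐ z ∂((pi0 F).prod haarG), 0 < Re z) ∧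
    TendstoInMeasure ((pi0 F).prod haarG) (fun (K : ℕ) (z : X0 F × G2) => R F γ K e z.1 z.2) atTop Re

/-- STUB A (XL, HARDEST): IN-MEASURE CONTINUUM LIMIT OF THE ONE-LINK COCYCLES, a.e. positive. -/
def CocycleLimitInMeasure : Prop :=
  ∃ γ₁ : ℝ, 0 < γ₁ ∧ ∀ (F : T3ContinuumYM3Torus.T3Family) (γ : ℝ), 0 < γ → γ ≤ γ₁ →
    ∀ e : PBond (F.P 0) 0, CocycleLimitAt F γ e

/-- The fibre-UI clause for one `(F, γ, e)`: `h ↦ R_{K,e}(V,h)` is Haar-uniformly integrable, uniformly in `K ≥ K₀`, in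
`π₀`-probability over the configuration `V` (typed with the lower integral `∫⁻` of the positive part `(R − M)₊`, so a
non-integrable fibre makes the clause FAIL rather than hold by the Bochner junk value — checklist 4c(ii)). -/
def FibreUIAt (γ : ℝ) (e : PBond (F.P 0) 0) : Prop :=
  ∀ ε : ℝ, 0 < ε → ∃ (M : ℝ) (K₀ : ℕ), ∀ K : ℕ, K₀ ≤ K →
    (pi0 F) {V : X0 F | ENNReal.ofReal ε < ∫⁻ h, ENNReal.ofReal (R F γ K e V h - M) ∂haarG} ≤ ENNReal.ofReal ε

/-- STUB C (L): NO CONDITIONAL MASS ESCAPES ALONG ONE-LINK FIBRES. -/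
def FibreUI : Prop :=
  ∃ γ₁ : ℝ, 0 < γ₁ ∧ ∀ (F : T3ContinuumYM3Torus.T3Family) (γ : ℝ), 0 < γ → γ ≤ γ₁ →
    ∀ e : PBond (F.P 0) 0, FibreUIAt F γ e

/-- STUB B (L, provable now, pure measure theory): THE BRIDGE from cocycle data to the specification limit. -/
def SpecificationFromCocycle : Prop :=
  ∀ (F : T3ContinuumYM3Torus.T3Family) (γ : ℝ), 0 < γ →
    (∀ K : ℕ, ∀ᵐ V ∂(pi0 F), 0 < ud F γ K V) →
    (∀ e : PBond (F.P 0) 0, CocycleLimitAt F γ e) →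
    (∀ e : PBond (F.P 0) 0, FibreUIAt F γ e) →
    CruxBody F γ

/-- STUB 5 (L, BC5 plan-only rung; not used in `_of_cocycle`). THE IN-MEASURE COCYCLE LIMIT ON THE SMALL-FIELD EVENT `PlaqSmall r`. -/
def SmallFieldCocycleLimit : Prop :=
  ∃ γ₁ : ℝ, 0 < γ₁ ∧ ∀ (F : T3ContinuumYM3Torus.T3Family) (γ : ℝ), 0 < γ → γ ≤ γ₁ → ∃ r : ℝ, 0 < r ∧
    ∀ e : PBond (F.P 0) 0, ∃ Re : X0 F × G2 → ℝ, Measurable Re ∧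
      TendstoInMeasure (((pi0 F).restrict {V | PlaqSmall r V}).prod haarG)
        (fun (K : ℕ) (z : X0 F × G2) => R F γ K e z.1 z.2) atTop Re

namespace __Registered
/-- registered stub alias (verbatim from the LINE-15 skeleton). -/ abbrev stub_unitDensityPosAE : Prop := UnitDensityPosAE
/-- registered stub alias (verbatim from the LINE-15 skeleton). -/ abbrev stub_cocycleLimitInMeasure : Prop := CocycleLimitInMeasure
/-- registered stub alias (verbatim from the LINE-15 skeleton). -/ abbrev stub_fibreUI : Prop := FibreUI
/-- registered stub alias (verbatim from the LINE-15 skeleton). -/ abbrev stub_specificationFromCocycle : Prop := SpecificationFromCocycle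
/-- registered stub alias (verbatim from the LINE-15 skeleton). -/ abbrev stub_smallFieldCocycleLimit : Prop := SmallFieldCocycleLimit
end __Registered


/-! ## The registered stub B, by name and signature -/

/-- **STUB B `stub_specificationFromCocycle` HOLDS** (pure measure theory: fibre integrals in measure + cocycle normalisation). -/
theorem stub_specificationFromCocycle : __Registered.stub_specificationFromCocycle :=
  Summit.QuantumFields.YangMills.Theorems.SpecificationCompactnessSpecificationFromCocycle.specificationFromCocycle

end Summit.QuantumFields.YangMills.Cruxes.SpecificationLimitAE.CocycleLimit

end
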